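import Literature.NumberTheory.LFunctions.ExceptionalPrimesAbel
import Mathlib.Analysis.Convex.SpecificFunctions.Basic
import HarnessLib

/-!
# Power sums `A(N) = ∑_{n ≤ N} n^{-β}` for `β` slightly below `1`: two-sided comparison with
# `N^{1-β}/(1-β)` by Bernoulli's inequality

Topic `Literature/NumberTheory/LFunctions`. Everything in this file is PROVED (theorems only);
second support file of the elementary proof of Heath-Brown's lemma on exceptional primes
(`ExceptionalPrimesSparse.lean`). For `0 < κ = 1 − β ≤ 1` Bernoulli's inequality
`(1 + s)^κ ≤ 1 + κ s` (`s ≥ −1`; Mathlib's `rpow_one_add_le_one_add_mul_self`) gives the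
secant bounds `κ x^{κ−1}(x − y) ≤ x^κ − y^κ ≤ κ y^{κ−1}(x − y)` (`0 < y ≤ x`), whence, summing
`n ↦ (n+1)^κ − n^κ`:

* `sum_Ioc_rpow_bounds` — for `1 ≤ N ≤ M`,
  `(M^{1−β} − N^{1−β})/(1−β) − N^{−β} ≤ ∑_{N<n≤M} n^{−β} ≤ (M^{1−β} − N^{1−β})/(1−β)`;
* `sum_Icc_rpow_le`, `le_sum_Icc_rpow`, `abs_sum_Icc_rpow_sub_le`, `sum_Icc_rpow_le_log` —
  `(N^{1−β} − 1)/(1−β) ≤ ∑_{n≤N} n^{−β} ≤ 1 + (N^{1−β} − 1)/(1−β) ≤ 1 + N^{1−β} log N`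
  (`e^u − 1 ≤ u e^u`), so `|A(N) − N^{1−β}/(1−β)| ≤ 1/(1−β)`;
* `rpow_sub_floor_rpow_bounds` — `0 ≤ t^{1−β} − ⌊t⌋^{1−β} ≤ (1−β) ⌊t⌋^{−β}` for `t ≥ 1`.

No limits and no constant `ζ(β)` are needed: only DIFFERENCES `A(M) − A(N)` enter the hyperbola
argument of `ExceptionalPrimesHyperbola.lean`.

## References

* H. L. Montgomery, R. C. Vaughan, *Multiplicative Number Theory I*, CUP 2007, §1.3
  (comparison of sums with integrals). [MontgomeryVaughan2007]
-/

noncomputable section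

open Finset

namespace Literature.NumberTheory.LFunctions.SiegelZero

/-! ### Secant bounds for `x ↦ x^κ`, `0 ≤ κ ≤ 1` -/

/-- **Upper secant bound** (Bernoulli): for `0 < y ≤ x` and `0 ≤ κ ≤ 1`,
`x^κ − y^κ ≤ κ y^{κ−1} (x − y)`. [folklore] -/
theorem rpow_sub_rpow_le_mul {x y κ : ℝ} (hy : 0 < y) (hyx : y ≤ x) (hκ0 : 0 ≤ κ) (hκ1 : κ ≤ 1) :
    x ^ κ - y ^ κ ≤ κ * y ^ (κ - 1) * (x - y) := by
  have hs : -1 ≤ (x - y) / y := le_trans (by norm_num) (div_nonneg (by linarith) hy.le)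
  have hB := rpow_one_add_le_one_add_mul_self hs hκ0 hκ1
  have hx : x = y * (1 + (x - y) / y) := by field_simp; ring
  have h1 : x ^ κ = y ^ κ * (1 + (x - y) / y) ^ κ := by
    rw [hx, Real.mul_rpow hy.le (by linarith)]
    congr 1
    rw [← hx]
  have hyk : 0 ≤ y ^ κ := Real.rpow_nonneg hy.le κ
  have h2 : y ^ κ * (1 + (x - y) / y) ^ κ ≤ y ^ κ * (1 + κ * ((x - y) / y)) :=
    mul_le_mul_of_nonneg_left hB hyk
  have h3 : y ^ κ * (1 + κ * ((x - y) / y)) = y ^ κ + κ * y ^ (κ - 1) * (x - y) := by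
    rw [Real.rpow_sub_one hy.ne']
    field_simp
  linarith [h1, h2, h3]

/-- **Lower secant bound** (Bernoulli): for `0 < y ≤ x` and `0 ≤ κ ≤ 1`,
`κ x^{κ−1} (x − y) ≤ x^κ − y^κ`. [folklore] -/
theorem mul_le_rpow_sub_rpow {x y κ : ℝ} (hy : 0 < y) (hyx : y ≤ x) (hκ0 : 0 ≤ κ) (hκ1 : κ ≤ 1) :
    κ * x ^ (κ - 1) * (x - y) ≤ x ^ κ - y ^ κ := by
  have hx : 0 < x := lt_of_lt_of_le hy hyx
  have hs : -1 ≤ -((x - y) / x) := by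
    rw [neg_le_neg_iff, div_le_one hx]
    linarith
  have hB := rpow_one_add_le_one_add_mul_self hs hκ0 hκ1
  have hy' : y = x * (1 + -((x - y) / x)) := by field_simp; ring
  have h1 : y ^ κ = x ^ κ * (1 + -((x - y) / x)) ^ κ := by
    rw [hy', Real.mul_rpow hx.le (by linarith)]
    congr 1
    rw [← hy']
  have hxk : 0 ≤ x ^ κ := Real.rpow_nonneg hx.le κ
  have h2 : x ^ κ * (1 + -((x - y) / x)) ^ κ ≤ x ^ κ * (1 + κ * -((x - y) / x)) :=
    mul_le_mul_of_nonneg_left hB hxk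
  have h3 : x ^ κ * (1 + κ * -((x - y) / x)) = x ^ κ - κ * x ^ (κ - 1) * (x - y) := by
    rw [Real.rpow_sub_one hx.ne']
    field_simp
    ring
  linarith [h1, h2, h3]

/-- The unit step: for `n > 0` (real) and `0 < β ≤ 1`... in the form used below: for a real
`x ≥ 1` and `0 ≤ β < 1`, `(1−β)(x+1)^{−β} ≤ (x+1)^{1−β} − x^{1−β} ≤ (1−β) x^{−β}`. [folklore] -/
theorem rpow_succ_sub_rpow_bounds {x β : ℝ} (hx : 0 < x) (hβ0 : 0 ≤ β) (hβ1 : β < 1) :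
    (1 - β) * (x + 1) ^ (-β) ≤ (x + 1) ^ (1 - β) - x ^ (1 - β) ∧
      (x + 1) ^ (1 - β) - x ^ (1 - β) ≤ (1 - β) * x ^ (-β) := by
  have hκ0 : 0 ≤ 1 - β := by linarith
  have hκ1 : 1 - β ≤ 1 := by linarith
  have e : (1 - β) - 1 = -β := by ring
  constructor
  · have h := mul_le_rpow_sub_rpow (x := x + 1) (y := x) (κ := 1 - β) hx (by linarith) hκ0 hκ1
    rw [e] at h
    simpa using h
  · have h := rpow_sub_rpow_le_mul (x := x + 1) (y := x) (κ := 1 - β) hx (by linarith) hκ0 hκ1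
    rw [e] at h
    simpa using h

/-! ### Sums over windows

Telescoping `∑_{N ≤ n < M} (g(n+1) − g(n)) = g(M) − g(N)` is Mathlib's `Finset.sum_Ico_sub`. -/

/-- Shift: `∑_{N<n≤M} f(n) = ∑_{N≤n<M} f(n+1)`. [folklore] -/
theorem sum_Ioc_eq_sum_Ico_succ {α : Type*} [AddCommMonoid α] (f : ℕ → α) {N M : ℕ} (h : N ≤ M) :
    ∑ n ∈ Ioc N M, f n = ∑ n ∈ Ico N M, f (n + 1) := by
  induction M, h using Nat.le_induction with
  | base => simp
  | succ M hNM ih => rw [Finset.sum_Ioc_succ_top hNM, Finset.sum_Ico_succ_top hNM, ih]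

/-- Shift the other way: `∑_{N≤n<M} f(n) = f(N) − f(M) + ∑_{N<n≤M} f(n)` for `N ≤ M`. [folklore] -/
theorem sum_Ico_eq_sum_Ioc_add_sub (f : ℕ → ℝ) {N M : ℕ} (h : N ≤ M) :
    ∑ n ∈ Ico N M, f n = ∑ n ∈ Ioc N M, f n + f N - f M := by
  induction M, h using Nat.le_induction with
  | base => simp
  | succ M hNM ih =>
    rw [Finset.sum_Ioc_succ_top hNM, Finset.sum_Ico_succ_top hNM, ih]
    ring

/-- **Upper bound for a window of `n^{−β}`**: for `1 ≤ N ≤ M` and `0 ≤ β < 1`,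
`(1−β) ∑_{N<n≤M} n^{−β} ≤ M^{1−β} − N^{1−β}`. [folklore] -/
theorem mul_sum_Ioc_rpow_le {β : ℝ} (hβ0 : 0 ≤ β) (hβ1 : β < 1) {N M : ℕ} (hN : 1 ≤ N)
    (h : N ≤ M) :
    (1 - β) * ∑ n ∈ Ioc N M, (n : ℝ) ^ (-β) ≤ (M : ℝ) ^ (1 - β) - (N : ℝ) ^ (1 - β) := by
  rw [← Finset.sum_Ico_sub (fun n : ℕ => (n : ℝ) ^ (1 - β)) h, Finset.mul_sum,
    sum_Ioc_eq_sum_Ico_succ _ h]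
  refine Finset.sum_le_sum fun n hn => ?_
  have hn1 : (0 : ℝ) < n := by exact_mod_cast lt_of_lt_of_le hN (Finset.mem_Ico.mp hn).1
  have := (rpow_succ_sub_rpow_bounds hn1 hβ0 hβ1).1
  push_cast
  exact this

/-- **Lower bound for a window of `n^{−β}`**: for `1 ≤ N ≤ M` and `0 ≤ β < 1`,
`M^{1−β} − N^{1−β} ≤ (1−β) (∑_{N<n≤M} n^{−β} + N^{−β} − M^{−β})`. [folklore] -/
theorem rpow_sub_rpow_le_mul_sum_Ioc {β : ℝ} (hβ0 : 0 ≤ β) (hβ1 : β < 1) {N M : ℕ} (hN : 1 ≤ N)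
    (h : N ≤ M) :
    (M : ℝ) ^ (1 - β) - (N : ℝ) ^ (1 - β) ≤
      (1 - β) * (∑ n ∈ Ioc N M, (n : ℝ) ^ (-β) + (N : ℝ) ^ (-β) - (M : ℝ) ^ (-β)) := by
  rw [← Finset.sum_Ico_sub (fun n : ℕ => (n : ℝ) ^ (1 - β)) h,
    ← sum_Ico_eq_sum_Ioc_add_sub (fun n : ℕ => (n : ℝ) ^ (-β)) h, Finset.mul_sum]
  refine Finset.sum_le_sum fun n hn => ?_
  have hn1 : (0 : ℝ) < n := by exact_mod_cast lt_of_lt_of_le hN (Finset.mem_Ico.mp hn).1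
  have := (rpow_succ_sub_rpow_bounds hn1 hβ0 hβ1).2
  push_cast
  exact this

/-- **Two-sided comparison of `A(M) − A(N)` with `(M^{1−β} − N^{1−β})/(1−β)`**: for
`1 ≤ N ≤ M` and `0 ≤ β < 1` there is `θ ∈ [0, N^{−β}]` with
`∑_{N<n≤M} n^{−β} = (M^{1−β} − N^{1−β})/(1−β) − θ`. Stated as the two inequalities. [folklore] -/
theorem sum_Ioc_rpow_bounds {β : ℝ} (hβ0 : 0 ≤ β) (hβ1 : β < 1) {N M : ℕ} (hN : 1 ≤ N)
    (h : N ≤ M) :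
    ((M : ℝ) ^ (1 - β) - (N : ℝ) ^ (1 - β)) / (1 - β) - (N : ℝ) ^ (-β) ≤
        ∑ n ∈ Ioc N M, (n : ℝ) ^ (-β) ∧
      ∑ n ∈ Ioc N M, (n : ℝ) ^ (-β) ≤ ((M : ℝ) ^ (1 - β) - (N : ℝ) ^ (1 - β)) / (1 - β) := by
  have hκ : 0 < 1 - β := by linarith
  constructor
  · have h1 := rpow_sub_rpow_le_mul_sum_Ioc hβ0 hβ1 hN h
    have hM : 0 ≤ (M : ℝ) ^ (-β) := Real.rpow_nonneg (Nat.cast_nonneg M) _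
    rw [sub_le_iff_le_add, div_le_iff₀ hκ]
    nlinarith
  · rw [le_div_iff₀ hκ, mul_comm]
    exact mul_sum_Ioc_rpow_le hβ0 hβ1 hN h

/-! ### The full sum `A(N) = ∑_{n ≤ N} n^{−β}` -/

/-- `(N^{1−β} − 1)/(1−β) ≤ N^{1−β} log N` for `N ≥ 1` and `β < 1`. [folklore] -/
theorem rpow_sub_one_div_le {β : ℝ} (hβ1 : β < 1) {x : ℝ} (hx : 1 ≤ x) :
    (x ^ (1 - β) - 1) / (1 - β) ≤ x ^ (1 - β) * Real.log x := by
  have hκ : 0 < 1 - β := by linarith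
  have hx0 : 0 < x := by linarith
  have hlog : 0 ≤ Real.log x := Real.log_nonneg hx
  have hexp : x ^ (1 - β) = Real.exp ((1 - β) * Real.log x) := by
    rw [Real.rpow_def_of_pos hx0, mul_comm]
  rw [div_le_iff₀ hκ, hexp]
  -- `e^u − 1 ≤ u e^u` with `u = (1 − β) log x`, from `1 − u ≤ e^{−u}`
  set u : ℝ := (1 - β) * Real.log x with hu
  have h := Real.one_sub_le_exp_neg u
  have he : 0 < Real.exp u := Real.exp_pos u
  have h2 : Real.exp u * (1 - u) ≤ Real.exp u * Real.exp (-u) := mul_le_mul_of_nonneg_left h he.le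
  rw [← Real.exp_add, add_neg_cancel, Real.exp_zero] at h2
  nlinarith

/-- **`A(N) ≤ 1 + (N^{1−β} − 1)/(1−β)`** for `N ≥ 1`, `0 ≤ β < 1`. [folklore] -/
theorem sum_Icc_rpow_le {β : ℝ} (hβ0 : 0 ≤ β) (hβ1 : β < 1) {N : ℕ} (hN : 1 ≤ N) :
    ∑ n ∈ Icc 1 N, (n : ℝ) ^ (-β) ≤ 1 + ((N : ℝ) ^ (1 - β) - 1) / (1 - β) := by
  have hsplit : ∑ n ∈ Icc 1 N, (n : ℝ) ^ (-β) = 1 + ∑ n ∈ Ioc 1 N, (n : ℝ) ^ (-β) := by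
    have hI : Finset.Icc 1 N = Finset.Ioc 0 N := by
      ext n; simp only [Finset.mem_Icc, Finset.mem_Ioc]; omega
    rw [hI, ← Finset.sum_Ioc_consecutive _ (Nat.zero_le 1) hN]
    simp
  rw [hsplit]
  have := (sum_Ioc_rpow_bounds hβ0 hβ1 le_rfl hN).2
  simp only [Nat.cast_one, Real.one_rpow] at this
  linarith

/-- **`A(N) ≥ (N^{1−β} − 1)/(1−β)`** for `N ≥ 1`, `0 ≤ β < 1`. [folklore] -/
theorem le_sum_Icc_rpow {β : ℝ} (hβ0 : 0 ≤ β) (hβ1 : β < 1) {N : ℕ} (hN : 1 ≤ N) :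
    ((N : ℝ) ^ (1 - β) - 1) / (1 - β) ≤ ∑ n ∈ Icc 1 N, (n : ℝ) ^ (-β) := by
  have hsplit : ∑ n ∈ Icc 1 N, (n : ℝ) ^ (-β) = 1 + ∑ n ∈ Ioc 1 N, (n : ℝ) ^ (-β) := by
    have hI : Finset.Icc 1 N = Finset.Ioc 0 N := by
      ext n; simp only [Finset.mem_Icc, Finset.mem_Ioc]; omega
    rw [hI, ← Finset.sum_Ioc_consecutive _ (Nat.zero_le 1) hN]
    simp
  rw [hsplit]
  have := (sum_Ioc_rpow_bounds hβ0 hβ1 le_rfl hN).1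
  simp only [Nat.cast_one, Real.one_rpow] at this
  linarith

/-- **`|A(N) − N^{1−β}/(1−β)| ≤ 1/(1−β)`** for `N ≥ 1`, `0 ≤ β < 1` (both one-sided bounds).
[folklore] -/
theorem abs_sum_Icc_rpow_sub_le {β : ℝ} (hβ0 : 0 ≤ β) (hβ1 : β < 1) {N : ℕ} (hN : 1 ≤ N) :
    |∑ n ∈ Icc 1 N, (n : ℝ) ^ (-β) - (N : ℝ) ^ (1 - β) / (1 - β)| ≤ 1 / (1 - β) := by
  have hκ : 0 < 1 - β := by linarith
  have h1 := sum_Icc_rpow_le hβ0 hβ1 hN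
  have h2 := le_sum_Icc_rpow hβ0 hβ1 hN
  have hκ1 : 1 ≤ 1 / (1 - β) := by rw [le_div_iff₀ hκ]; linarith
  rw [abs_le]
  constructor
  · have : ((N : ℝ) ^ (1 - β) - 1) / (1 - β) = (N : ℝ) ^ (1 - β) / (1 - β) - 1 / (1 - β) := by ring
    linarith
  · have : ((N : ℝ) ^ (1 - β) - 1) / (1 - β) = (N : ℝ) ^ (1 - β) / (1 - β) - 1 / (1 - β) := by ring
    linarith

/-- **`A(N) ≤ 1 + N^{1−β} log N`** for `N ≥ 1`, `0 ≤ β < 1`. [folklore] -/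
theorem sum_Icc_rpow_le_log {β : ℝ} (hβ0 : 0 ≤ β) (hβ1 : β < 1) {N : ℕ} (hN : 1 ≤ N) :
    ∑ n ∈ Icc 1 N, (n : ℝ) ^ (-β) ≤ 1 + (N : ℝ) ^ (1 - β) * Real.log N := by
  have h1 := sum_Icc_rpow_le hβ0 hβ1 hN
  have h2 := rpow_sub_one_div_le hβ1 (x := (N : ℝ)) (by exact_mod_cast hN)
  linarith

/-- `A(N) ≥ 1` for `N ≥ 1` (the term `n = 1`), and `A(N) ≥ 0` always. [folklore] -/
theorem sum_Icc_rpow_nonneg (β : ℝ) (N : ℕ) : 0 ≤ ∑ n ∈ Icc 1 N, (n : ℝ) ^ (-β) :=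
  Finset.sum_nonneg fun n _ => Real.rpow_nonneg (Nat.cast_nonneg n) _

/-- Monotonicity of `A` in `N`. [folklore] -/
theorem sum_Icc_rpow_mono (β : ℝ) {N M : ℕ} (h : N ≤ M) :
    ∑ n ∈ Icc 1 N, (n : ℝ) ^ (-β) ≤ ∑ n ∈ Icc 1 M, (n : ℝ) ^ (-β) :=
  Finset.sum_le_sum_of_subset_of_nonneg (Finset.Icc_subset_Icc_right h)
    fun n _ _ => Real.rpow_nonneg (Nat.cast_nonneg n) _

/-! ### Real arguments: the floor -/

/-- **`t^{1−β} − ⌊t⌋^{1−β} ≤ (1−β) ⌊t⌋^{−β}`** for `t ≥ 1`, `0 ≤ β < 1` (upper secant bound with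
`t − ⌊t⌋ < 1`); and `⌊t⌋^{1−β} ≤ t^{1−β}`. [folklore] -/
theorem rpow_sub_floor_rpow_bounds {β : ℝ} (hβ0 : 0 ≤ β) (hβ1 : β < 1) {t : ℝ} (ht : 1 ≤ t) :
    0 ≤ t ^ (1 - β) - (⌊t⌋₊ : ℝ) ^ (1 - β) ∧
      t ^ (1 - β) - (⌊t⌋₊ : ℝ) ^ (1 - β) ≤ (1 - β) * (⌊t⌋₊ : ℝ) ^ (-β) := by
  have hT1 : (1 : ℝ) ≤ ⌊t⌋₊ := by exact_mod_cast Nat.le_floor (by exact_mod_cast ht)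
  have hT0 : (0 : ℝ) < ⌊t⌋₊ := by linarith
  have hTt : (⌊t⌋₊ : ℝ) ≤ t := Nat.floor_le (by linarith)
  have hlt : t - ⌊t⌋₊ < 1 := by linarith [Nat.lt_floor_add_one t]
  constructor
  · exact sub_nonneg.mpr (Real.rpow_le_rpow hT0.le hTt (by linarith))
  · have h := rpow_sub_rpow_le_mul (κ := 1 - β) hT0 hTt (by linarith) (by linarith)
    have e : (1 - β) - 1 = -β := by ring
    rw [e] at h
    have hpos : 0 ≤ (1 - β) * (⌊t⌋₊ : ℝ) ^ (-β) := mul_nonneg (by linarith) (Real.rpow_nonneg hT0.le _)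
    calc t ^ (1 - β) - (⌊t⌋₊ : ℝ) ^ (1 - β) ≤ (1 - β) * (⌊t⌋₊ : ℝ) ^ (-β) * (t - ⌊t⌋₊) := h
      _ ≤ (1 - β) * (⌊t⌋₊ : ℝ) ^ (-β) * 1 := by gcongr
      _ = (1 - β) * (⌊t⌋₊ : ℝ) ^ (-β) := mul_one _

end Literature.NumberTheory.LFunctions.SiegelZero

end
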